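import Summits.QuantumFields.BalabanUV.T4Continuum.Support.NE7EJBracketPath
import Summits.QuantumFields.BalabanUV.T4Continuum.Support.NE7K1LinTwoRunMonotone

/-!
# NE7EJBracketTwoCutoff — row NE7 (node U5), candidate route HOM: THE JUNCTION BRACKET OF THE TWO-CUTOFF COMPARISON — THE
# K1-lin(s) LINE `twoCutoffLine s = (1−s)P_A + s·P_B^{Schur}` IS THE E-JUNCTION τ-LINE AT THE GAUSSIAN LEVEL, SO FILES 106–109 APPLY:
# for EVERY family of independent linear constraints the bracket is `≥ 0`, `≤` the (K2)♯-defect at run A's constrained minimiser,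
# CONCAVE along the line, differentiable with derivative the defect at the line's minimiser, and `= ∫₀¹` of it

Lineage `b2b-balaban-t4-ne7-p2` (CRUX PROVER NE7 #2 = C-HOM°'s kernel hand), generation 80; file 111 (after 106–110).  THE DOCKING of the
E-junction files to this lineage's cell K1-lin(s): lens 1's ▶v3.150 lists K1-lin(s) as «DELETED on EJ … p2's `Support/NE7K1Lin*` files stay
valid mathematics for H1L and B4-type operator theory; EJ does not consume them».  At the Gaussian (A = 0, U = 1) level they ARE consumed:
with `K₀ := runA n L a R′ = P_A` (run A's step operator, `NE7K1LinSchurLineU1.runA`) and `E := twoCutoffLine 1 − runA = P_B^{Schur} − P_A`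
(the ONE-STEP QUADRATIC DEFECT; `⪰ 0` by lens 2's (K2)♯ lower half `NE7K1LinTwoRunJensen.runA_form_le_schurB_sharp`, IN KERNEL since gen 65),
`NE7K1LinTwoRunMonotone.twoCutoffLine_eq` says `twoCutoffLine s = K₀ + s•E = lineK K₀ E s` (file 109's line of forms), and
`twoCutoffLine_coercive_sharp` makes every `K_s`, `s ≥ 0`, positive definite.  Hence, for EVERY constraint map `Q` on run A's lattice with
independent rows (e.g. the level-`j₀` block averages of H1L-EJ's fibre — NOT instantiated here) and every block datum `B`:

* §1 `posDef_of_coercive` (a symmetric real matrix with `c‖v‖² ≤ ⟨v, Mv⟩`, `c > 0`, is positive definite); `twoCutoffDefect`,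
  `twoCutoffLine_eq_lineK`, `twoCutoffLine_zero_eq_runA`, **`twoCutoffLine_posDef`** (every `s ≥ 0`), `runA_posDef`, `runA_add_defect_posDef`,
  **`twoCutoffDefect_form_nonneg`** ∕ `twoCutoffDefect_posSemidef` (`E ⪰ 0`: (K2)♯).
* §2 THE EJ LETTERS OF THE TWO-CUTOFF COMPARISON (files 108 ∕ 109 BY NAME): **`ej_bracket_nonneg`** (`0 ≤ ⟨B, (P(P_B^{Schur})⁻¹ − P(P_A)⁻¹)B⟩`
  — the junction bracket of the two-cutoff comparison is NON-NEGATIVE for every constraint family: the monotonicity that F2 supplies in the road,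
  here from (K2)♯), **`ej_bracket_le_defect`** (`≤ ⟨H₀B, E H₀B⟩`, the defect at run A's constrained minimiser — EJ-1a), `ej_bracket_ge_defect`
  (`≥ ⟨H₁B, E H₁B⟩ ≥ 0`), **`ej_concaveOn`** ((E3) along HOM's line), **`ej_hasDerivWithinAt`** (Hellmann–Feynman: derivative = defect at the
  line's constrained minimiser), **`ej_integral`** ((E1): `= ∫₀¹ ⟨H_sB, E H_sB⟩ ds`), `ej_defect_antitoneOn`.

HONEST FRAMING: [folklore]; A = 0, U = 1 (the Gaussian caricature of H1L: two quadratic main actions on run A's lattice); the constraint map `Q`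
is a VARIABLE (the level-`j₀` averaging of the road is not instantiated); nothing of Bałaban's minimisers (B11) or of the non-abelian defect
(N1) is touched; NOT EJ-1c ∕ EJ-2 ∕ EJ-3; NOT a letter move (K1-lin(s) = S, EJ-1a XS, EJ-1b M–L — the desk's).  NE7 NOT PRINTED ∕ NOT PROVED;
spine 0∕9; FIXED FINITE T⁴, rung (B)+1; NOT infinite volume, NOT mass gap, NOT Clay.  HONEST DEPENDENCY: continuum YM on T⁴ ⇐ BetaPertH ∧ nine
spine estimates (0/9 proved); BetaPertH ⇐ (D1) ∧ (D4) ∧ CAP+tail; G-an2-4 gates asym, D1 and NE2/3/4.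
-/

noncomputable section

open Matrix Set MeasureTheory intervalIntegral

namespace Summit.QuantumFields.BalabanUV.T4Continuum.NE7EJBracketTwoCutoff

open Literature.MathematicalPhysics.QuantumFieldTheory.Balaban1983to89
open Literature.MathematicalPhysics.QuantumFieldTheory.Balaban1983to89.B4Reflection242
open Literature.MathematicalPhysics.QuantumFieldTheory.Balaban1983to89.B4Lower18
open Literature.MathematicalPhysics.QuantumFieldTheory.Balaban1983to89.Beta.Composition (blockProp)
open Literature.MathematicalPhysics.QuantumFieldTheory.Balaban1983to89.Beta.Envelope
open NE7K1LinSchurLineU1 NE7K1LinTwoRunMonotone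
open NE7EJBracket NE7EJBracketForms NE7EJBracketPath

/-! ### §1 The two-cutoff line as an E-junction line of forms -/

section Objects

/-- a symmetric real matrix with a coercivity constant is positive definite. [folklore] -/
theorem posDef_of_coercive {ι : Type*} [Fintype ι] {M : Matrix ι ι ℝ} (hM : M.IsSymm) {c : ℝ} (hc : 0 < c)
    (h : ∀ v : ι → ℝ, c * (v ⬝ᵥ v) ≤ v ⬝ᵥ (M *ᵥ v)) : M.PosDef := by
  refine PosDef.of_dotProduct_mulVec_pos ?_ fun v hv => ?_
  · rw [IsHermitian, conjTranspose_eq_transpose_of_trivial]; exact hM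
  · rw [star_trivial]
    have h0 : 0 ≤ v ⬝ᵥ v := Finset.sum_nonneg fun i _ => mul_self_nonneg (v i)
    have hne : v ⬝ᵥ v ≠ 0 := fun h' => hv (dotProduct_self_eq_zero.mp h')
    have hpos : 0 < v ⬝ᵥ v := lt_of_le_of_ne h0 (Ne.symm hne)
    exact lt_of_lt_of_le (mul_pos hc hpos) (h v)

variable {d n L : ℕ} [NeZero L] {R' : Finset (Fin (d + 1) → ℤ)}

/-- THE ONE-STEP QUADRATIC DEFECT of the two-cutoff comparison: `E := P_B^{Schur} − P_A = twoCutoffLine 1 − runA`. [folklore] -/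
def twoCutoffDefect (hR' : IsBlockUnion (n * L) R') (a : ℝ) : Matrix ↥(R'.image (blk L)) ↥(R'.image (blk L)) ℝ :=
  twoCutoffLine (isBlockUnion_fine hR') n a 1 - runA n L a R'

/-- unfolding. [folklore] -/
@[simp] theorem twoCutoffDefect_def (hR' : IsBlockUnion (n * L) R') (a : ℝ) :
    twoCutoffDefect hR' a = twoCutoffLine (isBlockUnion_fine hR') n a 1 - runA n L a R' := rfl

/-- **THE K1-lin(s) LINE IS THE EJ LINE OF FORMS**: `twoCutoffLine s = lineK P_A E s = P_A + s•(P_B^{Schur} − P_A)`. [folklore] -/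
theorem twoCutoffLine_eq_lineK (hR' : IsBlockUnion (n * L) R') (a s : ℝ) :
    twoCutoffLine (isBlockUnion_fine hR') n a s = lineK (runA n L a R') (twoCutoffDefect hR' a) s := by
  rw [lineK_apply, twoCutoffDefect_def, twoCutoffLine_eq (isBlockUnion_fine hR') n a s, smul_sub, sub_smul, one_smul]
  abel

/-- `twoCutoffLine 0 = P_A`. [folklore] -/
theorem twoCutoffLine_zero_eq_runA (hR' : IsBlockUnion (n * L) R') (a : ℝ) :
    twoCutoffLine (isBlockUnion_fine hR') n a 0 = runA n L a R' := by
  rw [twoCutoffLine_eq_lineK hR', lineK_zero]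

/-- `P_A + E = twoCutoffLine 1 = P_B^{Schur}`. [folklore] -/
theorem runA_add_defect (hR' : IsBlockUnion (n * L) R') (a : ℝ) :
    runA n L a R' + twoCutoffDefect hR' a = twoCutoffLine (isBlockUnion_fine hR') n a 1 := by
  rw [twoCutoffDefect_def, add_sub_cancel]

/-- **every point of the line with `s ≥ 0` is positive definite** (coercivity `min(2,a)`, `twoCutoffLine_coercive_sharp`). [folklore] -/
theorem twoCutoffLine_posDef (hn : 1 ≤ n) (hR' : IsBlockUnion (n * L) R') {a : ℝ} (ha : 0 < a) {s : ℝ} (hs : 0 ≤ s) :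
    (twoCutoffLine (isBlockUnion_fine hR') n a s).PosDef :=
  posDef_of_coercive (twoCutoffLine_isSymm (isBlockUnion_fine hR') n a s) (lt_min (by norm_num) ha)
    (twoCutoffLine_coercive_sharp hn hR' ha hs)

/-- `P_A ≻ 0`. [folklore] -/
theorem runA_posDef (hn : 1 ≤ n) (hR' : IsBlockUnion (n * L) R') {a : ℝ} (ha : 0 < a) : (runA n L a R').PosDef := by
  rw [← twoCutoffLine_zero_eq_runA hR' a]
  exact twoCutoffLine_posDef hn hR' ha (le_refl _)

/-- `P_A + E = P_B^{Schur} ≻ 0`. [folklore] -/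
theorem runA_add_defect_posDef (hn : 1 ≤ n) (hR' : IsBlockUnion (n * L) R') {a : ℝ} (ha : 0 < a) :
    (runA n L a R' + twoCutoffDefect hR' a).PosDef := by
  rw [runA_add_defect]
  exact twoCutoffLine_posDef hn hR' ha zero_le_one

/-- **`E ⪰ 0` AS A FORM**: `0 ≤ ⟨v, (P_B^{Schur} − P_A)v⟩` — lens 2's (K2)♯ lower half (`runA_form_le_schurB_sharp`, via
`runA_form_le_twoCutoffLine` at `s = 1`). [folklore] -/
theorem twoCutoffDefect_form_nonneg (hn : 1 ≤ n) (hR' : IsBlockUnion (n * L) R') {a : ℝ} (ha : 0 < a) (v : ↥(R'.image (blk L)) → ℝ) :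
    0 ≤ v ⬝ᵥ (twoCutoffDefect hR' a *ᵥ v) := by
  have h := runA_form_le_twoCutoffLine hn hR' ha zero_le_one v
  rw [twoCutoffDefect_def, sub_mulVec, dotProduct_sub]
  linarith

/-- `E` is positive semidefinite. [folklore] -/
theorem twoCutoffDefect_posSemidef (hn : 1 ≤ n) (hR' : IsBlockUnion (n * L) R') {a : ℝ} (ha : 0 < a) :
    (twoCutoffDefect hR' a).PosSemidef := by
  refine posSemidef_of_qf_nonneg ?_ (twoCutoffDefect_form_nonneg hn hR' ha)
  rw [twoCutoffDefect_def, transpose_sub, (twoCutoffLine_isSymm (isBlockUnion_fine hR') n a 1).eq,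
    ← twoCutoffLine_zero_eq_runA hR' a, (twoCutoffLine_isSymm (isBlockUnion_fine hR') n a 0).eq]

end Objects

/-! ### §2 The EJ letters of the two-cutoff comparison, for every family of independent constraints -/

section EJ

variable {d n L : ℕ} [NeZero L] {R' : Finset (Fin (d + 1) → ℤ)}
variable {μ : Type*} [Fintype μ] [DecidableEq μ]

/-- **THE BRACKET IS NON-NEGATIVE**: for every constraint map `Q` with independent rows and every block datum `B`,
`0 ≤ ⟨H₁B, E H₁B⟩ ≤ ⟨B, (P(P_B^{Schur})⁻¹ − P(P_A)⁻¹) B⟩` — integrating out run B's extra layer RAISES the constrained effective form (the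
sign F2 gives in the road, here from (K2)♯ and file 108's sandwich). [folklore] -/
theorem ej_bracket_ge_defect (hn : 1 ≤ n) (hR' : IsBlockUnion (n * L) R') {a : ℝ} (ha : 0 < a)
    {Q : Matrix μ ↥(R'.image (blk L)) ℝ} (hQ : Function.Injective Q.vecMul) (B : μ → ℝ) :
    0 ≤ qf (twoCutoffDefect hR' a) (minMap (twoCutoffLine (isBlockUnion_fine hR') n a 1) Q *ᵥ B) ∧
      qf (twoCutoffDefect hR' a) (minMap (twoCutoffLine (isBlockUnion_fine hR') n a 1) Q *ᵥ B) ≤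
        B ⬝ᵥ (((blockProp (twoCutoffLine (isBlockUnion_fine hR') n a 1) Q)⁻¹ - (blockProp (runA n L a R') Q)⁻¹) *ᵥ B) := by
  have h0 := runA_posDef hn hR' ha
  have h1 := runA_add_defect_posDef hn hR' ha
  have hs := forms_sandwich h0 h1 hQ B
  rw [add_sub_cancel_left, runA_add_defect] at hs
  exact ⟨twoCutoffDefect_form_nonneg hn hR' ha _, hs.1⟩

/-- **`0 ≤ Br`**. [folklore] -/
theorem ej_bracket_nonneg (hn : 1 ≤ n) (hR' : IsBlockUnion (n * L) R') {a : ℝ} (ha : 0 < a)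
    {Q : Matrix μ ↥(R'.image (blk L)) ℝ} (hQ : Function.Injective Q.vecMul) (B : μ → ℝ) :
    0 ≤ B ⬝ᵥ (((blockProp (twoCutoffLine (isBlockUnion_fine hR') n a 1) Q)⁻¹ - (blockProp (runA n L a R') Q)⁻¹) *ᵥ B) := by
  obtain ⟨h1, h2⟩ := ej_bracket_ge_defect hn hR' ha hQ B
  exact h1.trans h2

/-- **EJ-1a FOR THE TWO-CUTOFF COMPARISON**: `Br ≤ ⟨H₀B, E H₀B⟩` — the bracket is at most the (K2)♯-defect at run A's OWN constrained
minimiser `H₀B = minMap P_A Q B`. [folklore] -/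
theorem ej_bracket_le_defect (hn : 1 ≤ n) (hR' : IsBlockUnion (n * L) R') {a : ℝ} (ha : 0 < a)
    {Q : Matrix μ ↥(R'.image (blk L)) ℝ} (hQ : Function.Injective Q.vecMul) (B : μ → ℝ) :
    B ⬝ᵥ (((blockProp (twoCutoffLine (isBlockUnion_fine hR') n a 1) Q)⁻¹ - (blockProp (runA n L a R') Q)⁻¹) *ᵥ B) ≤
      qf (twoCutoffDefect hR' a) (minMap (runA n L a R') Q *ᵥ B) := by
  have h0 := runA_posDef hn hR' ha
  have h1 := runA_add_defect_posDef hn hR' ha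
  have hs := forms_sandwich h0 h1 hQ B
  rw [add_sub_cancel_left, runA_add_defect] at hs
  exact hs.2

/-- **(E3) ALONG HOM's LINE**: `s ↦ ⟨B, P(twoCutoffLine s)⁻¹ B⟩` is CONCAVE on `[0,1]`. [folklore] -/
theorem ej_concaveOn (hn : 1 ≤ n) (hR' : IsBlockUnion (n * L) R') {a : ℝ} (ha : 0 < a)
    {Q : Matrix μ ↥(R'.image (blk L)) ℝ} (hQ : Function.Injective Q.vecMul) (B : μ → ℝ) :
    ConcaveOn ℝ (Icc (0:ℝ) 1) (fun s => B ⬝ᵥ ((blockProp (twoCutoffLine (isBlockUnion_fine hR') n a s) Q)⁻¹ *ᵥ B)) := by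
  have h := concaveOn_lineValue (runA_posDef hn hR' ha) (runA_add_defect_posDef hn hR' ha) hQ B
  refine h.congr fun s _ => ?_
  rw [lineValue_apply, ← twoCutoffLine_eq_lineK]

/-- the defect at the line's constrained minimiser, `s ↦ ⟨H_sB, E H_sB⟩`, is NON-INCREASING on `[0,1]`. [folklore] -/
theorem ej_defect_antitoneOn (hn : 1 ≤ n) (hR' : IsBlockUnion (n * L) R') {a : ℝ} (ha : 0 < a)
    {Q : Matrix μ ↥(R'.image (blk L)) ℝ} (hQ : Function.Injective Q.vecMul) (B : μ → ℝ) :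
    AntitoneOn (fun s => qf (twoCutoffDefect hR' a) (minMap (twoCutoffLine (isBlockUnion_fine hR') n a s) Q *ᵥ B)) (Icc (0:ℝ) 1) := by
  have h := defectForm_antitoneOn (runA_posDef hn hR' ha) (runA_add_defect_posDef hn hR' ha) hQ B
  refine h.congr fun s _ => ?_
  simp only [lineMin_apply, ← twoCutoffLine_eq_lineK]

/-- **HELLMANN–FEYNMAN FOR THE TWO-CUTOFF COMPARISON**: the constrained value is differentiable along the line within `[0,1]`, with derivative
the defect at the line's constrained minimiser `⟨H_sB, E H_sB⟩`. [folklore] -/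
theorem ej_hasDerivWithinAt (hn : 1 ≤ n) (hR' : IsBlockUnion (n * L) R') {a : ℝ} (ha : 0 < a)
    {Q : Matrix μ ↥(R'.image (blk L)) ℝ} (hQ : Function.Injective Q.vecMul) (B : μ → ℝ) {s : ℝ} (hs : s ∈ Icc (0:ℝ) 1) :
    HasDerivWithinAt (fun s => B ⬝ᵥ ((blockProp (twoCutoffLine (isBlockUnion_fine hR') n a s) Q)⁻¹ *ᵥ B))
      (qf (twoCutoffDefect hR' a) (minMap (twoCutoffLine (isBlockUnion_fine hR') n a s) Q *ᵥ B)) (Icc (0:ℝ) 1) s := by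
  have h := hasDerivWithinAt_lineValue (runA_posDef hn hR' ha) (runA_add_defect_posDef hn hR' ha) hQ B hs
  rw [lineMin_apply, ← twoCutoffLine_eq_lineK] at h
  refine h.congr (fun t _ => ?_) ?_
  · rw [lineValue_apply, ← twoCutoffLine_eq_lineK]
  · rw [lineValue_apply, ← twoCutoffLine_eq_lineK]

/-- **(E1) FOR THE TWO-CUTOFF COMPARISON**: the bracket is the `s`-AVERAGE of the defect at the line's constrained minimisers,
`⟨B, (P(P_B^{Schur})⁻¹ − P(P_A)⁻¹)B⟩ = ∫₀¹ ⟨H_sB, E H_sB⟩ ds`. [folklore] -/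
theorem ej_integral (hn : 1 ≤ n) (hR' : IsBlockUnion (n * L) R') {a : ℝ} (ha : 0 < a)
    {Q : Matrix μ ↥(R'.image (blk L)) ℝ} (hQ : Function.Injective Q.vecMul) (B : μ → ℝ) :
    B ⬝ᵥ (((blockProp (twoCutoffLine (isBlockUnion_fine hR') n a 1) Q)⁻¹ - (blockProp (runA n L a R') Q)⁻¹) *ᵥ B) =
      ∫ s in (0:ℝ)..1, qf (twoCutoffDefect hR' a) (minMap (twoCutoffLine (isBlockUnion_fine hR') n a s) Q *ᵥ B) := by
  have h := lineValue_one_sub_zero_eq_integral (runA_posDef hn hR' ha) (runA_add_defect_posDef hn hR' ha) hQ B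
  rw [runA_add_defect] at h
  rw [h]
  refine intervalIntegral.integral_congr fun s _ => ?_
  simp only [lineMin_apply, ← twoCutoffLine_eq_lineK]

end EJ

end Summit.QuantumFields.BalabanUV.T4Continuum.NE7EJBracketTwoCutoff

end
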